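import Summits.QuantumFields.YangMills.Theorems.BalabanUVNodesN07SeamNotInhabited
import HarnessLib

/-!
# N07 [B11] ∕ K0⁷ chart road — THE SEAM WITNESS, part D: the witness PACKAGED (∃-form), and ★★ THE CONVERSE OF MODULE 37a FAILS —
# «critical on the record's (b)-fibre» does NOT imply «critical on print's [II] (2.3)-fibre», on the record's own one-cube index, `N = 2`

Cell `pub-ymgap`, seat `pub-ymgap-dag-n07-w3` g15 (WIDTH SEAT 3 on N07).  `--kind proof --supports stmt-QuantumFields-20541 --as helper` (K0⁷; count-neutral;
NEGATIVE-SIDE helper).  [15] = [Balaban1985Variational]; [II] = [Balaban1984PropagatorsII]; [III] = [Balaban1988Convergent]; [I] = [Balaban1987RG1].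

WHY.  Part C₂ (`…N07SeamNotInhabited.not_hseam`) refutes the displayed premise HSEAM in its `¬ ∀` form.  This file states the same mathematics POSITIVELY, in the shape the
(E1) census and the planners read: on the torus `F.P 1` of EVERY family `F` there are an admissible (2.18) index `s` (dag-n21-c's one-cube index), a configuration `U`
and a curve `γ` through `U`, differentiable as a curve of bond matrices, such that (i) `U` IS a critical configuration of (5) on the RECORD's fibre of `𝐁 = genSet s.Ω 1`
(reading (b), `Node00.IsCritOnFibre`) for its own averages `W = M_𝐁(U)`; (ii) along `γ` every average on [II] (2.3)'s bonds `(domainsOfSeq s.Ω 1 _).LamBond` equals `W`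
(level `0` exactly, every level `≥ 1` exactly); (iii) `(A ∘ γ)′(0) = −sin 1 ≠ 0`.  Hence ★★ `exists_isCritOnFibre_genSet_not_lamBondCritical`: the implication of dag-n07-e's
MODULE 37a `…N07CritMultiScaleLamBond.isCritOnFibre_genSet_of_critLam` («(2.3)-critical ⇒ (b)-critical») is STRICT — its converse fails at the record's own objects
(the connector∕corner-transporter mechanism of `LOCATE-HSEAM` (iii), realised with NO minimiser: parts A–C).

HONEST FRAMING: count-neutral NEGATIVE-SIDE packaging of parts A–C₂ (no new estimate); nothing of Bałaban [15]∕[II]∕[III]∕[I] asserted or refuted (print's Prop. 8 is about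
the (2.3)-fibre; the witness is not (2.3)-critical — consistent with print); K0⁷ stub 1 NOT closed and NOT refuted; N05 ∕ N07 NOT discharged; counts unmoved (typed 28∕28 ·
discharged 8∕28); one finite 𝕋⁴ programme at fixed ε — R4 closes the conditional finite-𝕋⁴ rung `BalabanLadder.UV` only; the YM mass gap (Clay) is NOT proved by any of this;
nothing continuum ∕ ℝ⁴ ∕ OS.  No `def`, no `instance`, no `notation`, no `sorry`.

References: [15] (5)–(7) p. 278, (82) p. 290, Prop. 8 p. 304; [II] (2.1)–(2.3) p. 224; [III] (2.2) p. 255, (2.10)–(2.12) p. 256, (2.18) p. 257; [I] (0.1)–(0.4) pp. 251–253.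
-/

set_option autoImplicit false

noncomputable section

open scoped Matrix.Norms.L2Operator BigOperators Topology

namespace Summit.QuantumFields.YangMills.BalabanUVNodes.N07SeamWitness

open Filter
open Literature.MathematicalPhysics.QuantumFieldTheory.Balaban1983to89
open Literature.MathematicalPhysics.QuantumFieldTheory.Balaban1983to89.Node00
open Literature.MathematicalPhysics.QuantumFieldTheory.Balaban1983to89.T4Continuum
open B15Eq112TorusCover B14DomainGeom B15DeterminingSets B15LatticeCubeTorus BlockAveraging
open B6SectADomainsV1 (Domains)
open B5Eq118OneStroke (iterBlockOf iterBlockOf_zero iterBlockOf_succ)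
open ExpMeanLog (deltaSU expMeanLogSU deltaSU_pos)
open Summit.QuantumFields.YangMills.Theorems.FemtoTransferGap (diagSU2)
open Summit.QuantumFields.YangMills.Theorems.FemtoTransferGap.TwoLattice.Toron (coe_diagSU2 diagSU2_add diagSU2_zero diagSU2_neg)
open Summit.QuantumFields.YangMills.Theorems.K0VariationalThm1ScaledCorner (exists_seq_singleCube lt_sitesPerDir_zero)
open T4Continuum (T4Family)

/-- **★★ THE SEAM WITNESS, PACKAGED.**  On the torus `F.P 1` of every family: an admissible separated (2.18) index `s` of length `1` (dag-n21-c's one cube, `Ω₁ = Λ₁ = B(0)`,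
flat history, `M = 1`), a configuration `U` and a curve `γ` with `γ 0 = U`, differentiable as a curve of bond matrices, such that `U` is CRITICAL ON THE RECORD's FIBRE of
`genSet s.Ω 1` for its own averages, every average on [II] (2.3)'s bonds of the record's family `domainsOfSeq s.Ω 1` is CONSTANT along `γ` near `0`, and yet
`(A ∘ γ)′(0) = −sin 1`. [cite: Balaban1985Variational, (5)–(7) p.278; Balaban1984PropagatorsII, (2.3) p.224; Balaban1988Convergent, (2.2) p.255, (2.10)–(2.12) p.256] -/
theorem exists_seam_witness (F : T4Family) :
    ∃ (s : SeqOfRecord F numerics7OfRecord₁₂ 1 (fun _ => (1 : ℝ)) 1 1) (hkk : 1 ≤ (F.P 1).m + (F.P 1).K)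
      (U : GaugeField (F.P 1) 0 (SU 2)) (γ : ℝ → GaugeField (F.P 1) 0 (SU 2)),
      Sect2.SeqSeparated numerics7OfRecord₁₂.M₁ s ∧
      IsCritOnFibre F 2 1 (genSet s.Ω 1) (avgFamily (avOfRecord F 2 1) U) U ∧
      γ 0 = U ∧
      DifferentiableAt ℝ (fun (t : ℝ) (b : PBond (F.P 1) 0) => ((γ t b : SU 2) : Matrix (Fin 2) (Fin 2) ℂ)) 0 ∧
      (∀ᶠ t in 𝓝 (0 : ℝ), ∀ (j : ℕ) (c : PBond (F.P 1) j), (domainsOfSeq s.Ω 1 hkk).LamBond j c →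
        avgFamily (avOfRecord F 2 1) (γ t) j c = avgFamily (avOfRecord F 2 1) U j c) ∧
      HasDerivAt (fun t => wilsonAction4 (γ t)) (-Real.sin 1) 0 := by
  classical
  -- the torus `F.P 1`
  have hPL : (F.P 1).L = F.L := T4Family.P_L F 1
  have hPd : (F.P 1).d = 4 := T4Family.P_d F 1
  have hL11 : 11 < F.L := F.hL11
  have hsites : (F.P 1).sitesPerDir 0 = 2 * F.L ^ (F.m + 1) := T4Family.sitesPerDir_eq F 1
  have hper2 : 2 * (F.P 1).L < (F.P 1).sitesPerDir 0 := by
    rw [hsites, hPL]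
    have : F.L < F.L ^ (F.m + 1) := by
      calc F.L = F.L ^ 1 := (pow_one _).symm
        _ < F.L ^ (F.m + 1) := Nat.pow_lt_pow_right (by omega) (by have := F.hm; omega)
    omega
  have hL3 : 3 ≤ (F.P 1).L := by rw [hPL]; omega
  have hS3 : 3 < (F.P 1).sitesPerDir 0 := by omega
  have hS : ((F.P 1).L : ℤ) + 2 ≤ (F.P 1).sitesPerDir 0 := by
    have : (F.P 1).L + 2 ≤ (F.P 1).sitesPerDir 0 := by omega
    exact_mod_cast this
  have hj : 0 + 1 ≤ (F.P 1).m + (F.P 1).K := by rw [T4Family.P_m, T4Family.P_K]; have := F.hm; omega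
  have hkk : 1 ≤ (F.P 1).m + (F.P 1).K := by rw [T4Family.P_m, T4Family.P_K]; have := F.hm; omega
  -- directions `0 < 1`, `2`
  have h0d : 0 < (F.P 1).d := by rw [hPd]; norm_num
  have h1d : 1 < (F.P 1).d := by rw [hPd]; norm_num
  have h2d : 2 < (F.P 1).d := by rw [hPd]; norm_num
  have hνμ : (⟨1, h1d⟩ : Fin (F.P 1).d) ≠ ⟨0, h0d⟩ := by intro h; have := congrArg Fin.val h; simp at this
  have hκμ : (⟨2, h2d⟩ : Fin (F.P 1).d) ≠ ⟨0, h0d⟩ := by intro h; have := congrArg Fin.val h; simp at this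
  have hκν : (⟨2, h2d⟩ : Fin (F.P 1).d) ≠ ⟨1, h1d⟩ := by intro h; have := congrArg Fin.val h; simp at this
  have hμν : (⟨0, h0d⟩ : Fin (F.P 1).d) < ⟨1, h1d⟩ := Fin.mk_lt_mk.2 (by norm_num)
  -- the index
  obtain ⟨s, hsΩ, hsep⟩ := exists_seq_singleCube F numerics7OfRecord₁₂ 1
  have hsΩ' : s.Ω 1 = cubeEnl (F.P 1) (F.P 1).L 0 0 := by rw [hsΩ, hPL]
  -- the half block size and the centre of `B(0)`
  set hh : ℕ := ((F.P 1).L - 1) / 2 with hhh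
  have hL2 : 2 * hh + 1 = (F.P 1).L := AveragingRT.two_mul_half_add_one (F.P 1)
  have hemb0 : ∀ κ, emb (0 : Site (F.P 1) 1) κ = ((hh : ℕ) : ZMod ((F.P 1).sitesPerDir 0)) := by
    intro κ
    show (((((0 : Site (F.P 1) 1) κ).val * (F.P 1).L + ((F.P 1).L - 1) / 2 : ℕ)) : ZMod ((F.P 1).sitesPerDir 0)) = _
    rw [Site.zero_apply, ZMod.val_zero, zero_mul, zero_add]
  -- coordinates of `x = π(−1,−1,0,0)`, `x + e₁`, `x + 2e₁`; the connectors end in `B(0)`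
  have hA : ∀ κ, cover (F.P 1) (fun i => if i = (⟨0, h0d⟩ : Fin (F.P 1).d) ∨ i = ⟨1, h1d⟩ then (-1 : ℤ) else 0) κ =
      if κ = ⟨0, h0d⟩ ∨ κ = ⟨1, h1d⟩ then (-1 : ZMod ((F.P 1).sitesPerDir 0)) else 0 := by
    intro κ
    rw [cover_apply]
    by_cases h : κ = ⟨0, h0d⟩ ∨ κ = ⟨1, h1d⟩
    · simp only [h, if_true]; push_cast; ring
    · simp only [h, if_false]; push_cast; ring
  have hA1 : ∀ κ, ((cover (F.P 1) (fun i => if i = (⟨0, h0d⟩ : Fin (F.P 1).d) ∨ i = ⟨1, h1d⟩ then (-1 : ℤ) else 0)).shift ⟨1, h1d⟩) κ =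
      if κ = ⟨0, h0d⟩ then (-1 : ZMod ((F.P 1).sitesPerDir 0)) else 0 := by
    intro κ
    rw [Site.shift_apply, hA, hA]
    by_cases h1 : κ = ⟨1, h1d⟩
    · rw [if_pos h1, if_pos (Or.inr rfl), if_neg (h1 ▸ hνμ)]; ring
    · rw [if_neg h1]
      by_cases h0 : κ = ⟨0, h0d⟩
      · rw [if_pos (Or.inl h0), if_pos h0]
      · rw [if_neg (by push Not; exact ⟨h0, h1⟩), if_neg h0]
  have hA2 : ∀ κ, (((cover (F.P 1) (fun i => if i = (⟨0, h0d⟩ : Fin (F.P 1).d) ∨ i = ⟨1, h1d⟩ then (-1 : ℤ) else 0)).shift ⟨1, h1d⟩).shift ⟨1, h1d⟩) κ =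
      if κ = ⟨0, h0d⟩ then (-1 : ZMod ((F.P 1).sitesPerDir 0)) else if κ = ⟨1, h1d⟩ then 1 else 0 := by
    intro κ
    rw [Site.shift_apply, hA1, hA1, if_neg hνμ]
    by_cases h1 : κ = ⟨1, h1d⟩
    · rw [if_pos h1, if_neg (h1 ▸ hνμ), if_pos h1]; ring
    · rw [if_neg h1, if_neg h1]
  have htgt1 : blockOf (((cover (F.P 1) (fun i => if i = (⟨0, h0d⟩ : Fin (F.P 1).d) ∨ i = ⟨1, h1d⟩ then (-1 : ℤ) else 0)).shift ⟨1, h1d⟩).shift ⟨0, h0d⟩)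
      = 0 := by
    refine blockOf_eq_of_near_emb hj _ _ (fun _ => -(hh : ℤ)) (fun κ => ?_) (fun κ => ⟨le_rfl, by omega⟩)
    rw [hemb0, Site.shift_apply, hA1, hA1, if_pos rfl]
    by_cases h0 : κ = ⟨0, h0d⟩
    · rw [if_pos h0]; push_cast; ring
    · rw [if_neg h0, if_neg h0]; push_cast; ring
  have htgt2 : blockOf ((((cover (F.P 1) (fun i => if i = (⟨0, h0d⟩ : Fin (F.P 1).d) ∨ i = ⟨1, h1d⟩ then (-1 : ℤ) else 0)).shift ⟨1, h1d⟩).shift ⟨1, h1d⟩).shift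
      ⟨0, h0d⟩) = 0 := by
    refine blockOf_eq_of_near_emb hj _ _ (fun κ => if κ = ⟨1, h1d⟩ then 1 - (hh : ℤ) else -(hh : ℤ)) (fun κ => ?_) (fun κ => ?_)
    · rw [hemb0, Site.shift_apply, hA2, hA2, if_pos rfl]
      by_cases h0 : κ = ⟨0, h0d⟩
      · rw [if_pos h0, if_neg (h0 ▸ Ne.symm hνμ)]; push_cast; ring
      · rw [if_neg h0, if_neg h0]
        by_cases h1 : κ = ⟨1, h1d⟩
        · rw [if_pos h1, if_pos h1]; push_cast; ring
        · rw [if_neg h1, if_neg h1]; push_cast; ring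
    · by_cases h1 : κ = ⟨1, h1d⟩
      · rw [if_pos h1]; constructor <;> omega
      · rw [if_neg h1]; constructor <;> omega
  have hdeep0 : (0 : Site (F.P 1) 1) ∈ (domainsOfSeq s.Ω 1 hkk).Om 1 := by
    rw [mem_domainsOfSeq_Om_iff s.Ω hkk le_rfl]
    intro z hz i hi1 hi2
    obtain rfl : i = 1 := le_antisymm hi2 hi1
    rw [hsΩ']
    apply mem_cubeEnl_zero_of_blockOf_eq_zero hj
    simpa [iterBlockOf_succ, iterBlockOf_zero] using hz
  -- the witness
  refine ⟨s, hkk,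
    fun b : PBond (F.P 1) 0 =>
      if b.src = cover (F.P 1) (fun i => if i = (⟨0, h0d⟩ : Fin (F.P 1).d) ∨ i = ⟨1, h1d⟩ then (-1 : ℤ) else 0) ∧ b.dir = ⟨0, h0d⟩ then diagSU2 1 else 1,
    fun t b => (if b.src = (cover (F.P 1) (fun i => if i = (⟨0, h0d⟩ : Fin (F.P 1).d) ∨ i = ⟨1, h1d⟩ then (-1 : ℤ) else 0)).shift ⟨1, h1d⟩ ∧ b.dir = ⟨0, h0d⟩
        then diagSU2 t else 1) *
      (if b.src = ((cover (F.P 1) (fun i => if i = (⟨0, h0d⟩ : Fin (F.P 1).d) ∨ i = ⟨1, h1d⟩ then (-1 : ℤ) else 0)).shift ⟨1, h1d⟩).shift ⟨1, h1d⟩ ∧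
          b.dir = ⟨0, h0d⟩ then (diagSU2 t)⁻¹ else 1) *
      (if b.src = cover (F.P 1) (fun i => if i = (⟨0, h0d⟩ : Fin (F.P 1).d) ∨ i = ⟨1, h1d⟩ then (-1 : ℤ) else 0) ∧ b.dir = ⟨0, h0d⟩ then diagSU2 1 else 1),
    hsep, isCritOnFibre_extTwist F 2 1 hS s.Ω hsΩ' hνμ (diagSU2 1), ?_, (differentiable_twist (P := F.P 1) (μ0 := ⟨0, h0d⟩) (ν₁ := ⟨1, h1d⟩) 1) 0, ?_,
    hasDerivAt_wilsonAction4_twist hS3 hνμ hμν 1⟩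
  · funext b
    simp only [diagSU2_zero, inv_one]
    rw [ite_self, ite_self, one_mul, one_mul]
  · filter_upwards [eventually_dist1_diagSU2_lt] with t ht
    intro j c hjc
    rcases j with _ | j
    · -- level 0: only the two connectors move, and their far ends are deep
      show _ = (if c.src = _ ∧ c.dir = _ then diagSU2 1 else 1)
      by_contra hne'
      have hc' : (c.src = (cover (F.P 1) (fun i => if i = (⟨0, h0d⟩ : Fin (F.P 1).d) ∨ i = ⟨1, h1d⟩ then (-1 : ℤ) else 0)).shift ⟨1, h1d⟩ ∧
            c.dir = ⟨0, h0d⟩) ∨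
          (c.src = ((cover (F.P 1) (fun i => if i = (⟨0, h0d⟩ : Fin (F.P 1).d) ∨ i = ⟨1, h1d⟩ then (-1 : ℤ) else 0)).shift ⟨1, h1d⟩).shift ⟨1, h1d⟩ ∧
            c.dir = ⟨0, h0d⟩) := by
        by_contra hcon
        push Not at hcon
        apply hne'
        show (if _ then diagSU2 t else 1) * (if _ then (diagSU2 t)⁻¹ else 1) * _ = _
        rw [if_neg (fun h => hcon.1 h.1 h.2), if_neg (fun h => hcon.2 h.1 h.2), one_mul, one_mul]
      have hdeep : (domainsOfSeq s.Ω 1 hkk).Deep 0 c.tgt := by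
        show blockOf (c.src.shift c.dir) ∈ (domainsOfSeq s.Ω 1 hkk).Om 1
        rcases hc' with ⟨h1, h2⟩ | ⟨h1, h2⟩
        · rw [h1, h2, htgt1]; exact hdeep0
        · rw [h1, h2, htgt2]; exact hdeep0
      exact hjc.2.2 hdeep
    · -- levels `≥ 1`
      exact congrFun (iter_twist_eq (avOfRecord F 2 1) rfl hj hL3 hper2 hνμ hκμ hκν (diagSU2 t) (diagSU2 1) ht (j + 1) (by omega)) c

/-- **★★ THE CONVERSE OF MODULE 37a FAILS: (b)-CRITICAL DOES NOT IMPLY (2.3)-CRITICAL.**  On `F.P 1` (every `F`, `N = 2`) there are a (2.18) index `s`, a datum `W` and a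
configuration `U` agreeing with `W` on the record's determining set `genSet s.Ω 1` and CRITICAL ON THE RECORD's FIBRE (`IsCritOnFibre`), which is NOT critical along the curves
keeping the [II] (2.3)-averages of the record's family `domainsOfSeq s.Ω 1` (the hypothesis of dag-n07-e's `…N07CritMultiScaleLamBond.isCritOnFibre_genSet_of_critLam`, i.e.
HSEAM's conclusion shape) — the record's (b)-datum constrains strictly MORE than print's (2.3) class, and the extra constraints are ACTIVE (director-ym №335 (B)).
[cite: Balaban1985Variational, (5)–(7) p.278, (82) p.290, Prop. 8 p.304; Balaban1984PropagatorsII, (2.3) p.224; Balaban1988Convergent, (2.2) p.255, (2.10)–(2.12) p.256] -/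
theorem exists_isCritOnFibre_genSet_not_lamBondCritical (F : T4Family) :
    ∃ (s : SeqOfRecord F numerics7OfRecord₁₂ 1 (fun _ => (1 : ℝ)) 1 1) (hkk : 1 ≤ (F.P 1).m + (F.P 1).K)
      (W : MSField (F.P 1) (SU 2)) (U : GaugeField (F.P 1) 0 (SU 2)),
      AgreeOn (genSet s.Ω 1) (avgFamily (avOfRecord F 2 1) U) W ∧ IsCritOnFibre F 2 1 (genSet s.Ω 1) W U ∧
      ¬ (∀ γ : ℝ → GaugeField (F.P 1) 0 (SU 2), γ 0 = U →
          DifferentiableAt ℝ (fun (t : ℝ) (b : PBond (F.P 1) 0) => ((γ t b : SU 2) : Matrix (Fin 2) (Fin 2) ℂ)) 0 →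
            (∀ᶠ t in 𝓝 (0 : ℝ), ∀ (j : ℕ) (c : PBond (F.P 1) j), (domainsOfSeq s.Ω 1 hkk).LamBond j c →
              avgFamily (avOfRecord F 2 1) (γ t) j c = W j c) →
              ∀ a : ℝ, HasDerivAt (fun t => wilsonAction4 (γ t)) a 0 → a = 0) := by
  obtain ⟨s, hkk, U, γ, _, hcrit, hγ0, hγd, hlam, hder⟩ := exists_seam_witness F
  refine ⟨s, hkk, avgFamily (avOfRecord F 2 1) U, U, fun _ _ _ => rfl, hcrit, fun h => ?_⟩
  have h0 := h γ hγ0 hγd hlam (-Real.sin 1) hder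
  have hsin : 0 < Real.sin 1 := Real.sin_pos_of_pos_of_lt_pi one_pos (by linarith [Real.pi_gt_three])
  linarith

end Summit.QuantumFields.YangMills.BalabanUVNodes.N07SeamWitness

end
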